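import Summits.QuantumFields.YangMills.Theorems.BalabanUVNodesK2NamedJetsRemAt

/-! CRIT-2 g3 — counter-model to «under `ScaleAnchor` every in-box base-line limit exists and equals `b`, so R3 is implied»
(plan g84 WINDOW-OUTCOME (3)): `β k p := p 0` (reads the FIRST coupling) is anchored at `b := 0` (corner value), while on the
γ-base line `(γ,…,γ,g)` it is constantly `γ` for `k ≥ 1` — base-line limit `γ ≠ 0`.  Corner value and base-line value are
different numbers in general; they agree iff the remainder is face-independent at `g_k = 0` (print's (2.13)). -/

open Literature.MathematicalPhysics.QuantumFieldTheory.Balaban1983to89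
open Summit.QuantumFields.YangMills.Theorems.BalabanUVNodesK2NamedJetsRemAt

theorem crit2_scaleAnchor_firstCoord : ScaleAnchor (fun _ p => p 0) (fun _ => 0) := by
  intro k δ hδ
  refine ⟨δ, hδ, fun p hp => ?_⟩
  have h0 := hp 0
  rw [sub_zero, abs_of_pos h0.1]
  exact h0.2

theorem crit2_baseLine_firstCoord (k : ℕ) (hk : 0 < k) (γ g : ℝ) :
    (fun (_ : ℕ) (p : Fin (k + 1) → ℝ) => p 0) k (Function.update (fun _ => γ) (Fin.last k) g) = γ := by
  have hne : (0 : Fin (k + 1)) ≠ Fin.last k := by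
    intro h
    have := congrArg Fin.val h
    simp at this
    omega
  show Function.update (fun _ => γ) (Fin.last k) g 0 = γ
  rw [Function.update_of_ne hne]
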